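import Literature.Analysis.Fourier.RadialSchwartzInterpolation
import Mathlib.Analysis.Distribution.SchwartzSpace.Deriv
import Mathlib.Analysis.SpecificLimits.Basic
import Mathlib.Analysis.Calculus.SmoothSeries
import Mathlib.Analysis.PSeries
import HarnessLib

/-!
# CKMRV Theorem 1.9 (the interpolation isomorphism): the elementary half, and the reduction to
# the surjectivity of the data map

Analysis/Fourier proof file; sibling of `RadialSchwartzInterpolation` (the named facts
`CKMRV2022_interpolationFormula` = Cohn–Kumar–Miller–Radchenko–Viazovska, Ann. Math. 196 (2022),
Theorem 1.7, and `CKMRV2022_interpolationIso` = Theorem 1.9, schema `InterpolationIsomorphism d n₀`).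

## What is proved here

CKMRV §5.3, last paragraph of the proof of Theorem 1.9: "The image of the latter map is contained
in `𝓢(ℕ)⁴` because of the decay of Schwartz functions" — proved for every `(d, n₀)` and every
Schwartz `f` on `ℝᵈ` (`isRapidlyDecreasing_data`; the radial derivative `f′(r)` is the value at
`r e₀` of the Schwartz map `∂_{e₀} f`, `radialDeriv_eq_radialValue_lineDeriv`, and `f̂` is Schwartz).
This is part (i) of `InterpolationIsomorphism d n₀`.

The content of Theorem 1.9 beyond Theorem 1.7 is that the data map
`T : f ↦ ((f(√(2n)))ₙ, (f′(√(2n)))ₙ, (f̂(√(2n)))ₙ, (f̂′(√(2n)))ₙ)` is ONTO `𝓢(ℕ)⁴` (§1.4: "The only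
restriction on these sequences is on their decay rate"). We prove that this surjectivity alone
gives `InterpolationIsomorphism d n₀` for EVERY interpolation basis
(`interpolationIsomorphism_of_data_surjective`: expand a preimage `g` of `(α, β, α̃, β̃)` by the
basis identity (1.4) — its four series at `g` are `∑ αₙ aₙ(x)`, …, `∑ β̃ₙ b̃ₙ(x)`), that conversely
the isomorphism statement contains it (`InterpolationIsomorphism.data_surjective`), and hence
`CKMRV2022_interpolationIso` follows from the surjectivity of `T` for `(d, n₀) = (8, 1)` and
`(24, 2)` (`CKMRV2022_interpolationIso_of_data_surjective`).

## The synthesis step of §5.3 (proved here)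

"the image of the inverse map is a radial Schwartz function because the radial seminorms of the
interpolation basis grow at most polynomially by Theorem 3.1": for Schwartz functions `φᵢ` whose
every Schwartz seminorm `‖φᵢ‖_{k,n}` is `O(i^q)` and rapidly decreasing `(αᵢ)`, the series
`∑ αᵢ φᵢ` converges IN THE SCHWARTZ TOPOLOGY (`exists_schwartzMap_hasSum`; termwise
differentiation `contDiff_tsum_schwartz`, tails controlled seminorm by seminorm), so its four data
are the termwise sums (`hasSum_data`: each datum is a continuous linear functional — point
evaluation after `∂_{e₀}` and/or `𝓕`). Against a family with Kronecker data this realises any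
rapidly decreasing sequence in one slot (`exists_isRadial_data_eq_of_kronecker`), and by
additivity (`data_surjective_of_axes`) the four Kronecker families `aᵢ, bᵢ, ãᵢ, b̃ᵢ` of CKMRV
(data `(δ,0,0,0)`, `(0,δ,0,0)`, `(0,0,δ,0)`, `(0,0,0,δ)`, the display after Theorem 1.9) with
polynomial seminorm growth give the surjectivity of `T`, hence `InterpolationIsomorphism d n₀`
(`interpolationIsomorphism_of_kronecker_families`).

## The printed consequences of Theorem 1.9 (conditional on `InterpolationIsomorphism d n₀`)

The Kronecker data of `bₘ`, `ãₘ`, `b̃ₘ` (`InterpolationIsomorphism.data_b/data_a'/data_b'`,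
companions of `data_a` in the parent file) and "`ãₙ = âₙ`, `b̃ₙ = b̂ₙ`"
(`InterpolationIsomorphism.a'_eq_fourier_a`, `.b'_eq_fourier_b`; via `IsRadial.fourier` — the
Fourier transform of a radial function is radial — and `IsRadial.fourier_fourier`, `𝓕𝓕 = id` on
radial Schwartz functions).

## What is NOT proved here (the residual, = the construction of the basis)

The existence, for `(d, n₀) = (8, 1)` and `(24, 2)`, of the four Kronecker families with
polynomially growing seminorms — i.e. THE interpolation basis of Theorem 1.7 with the growth
bound of Theorem 3.1 (functional equations for the generating functions ⇒ interpolation formula,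
built in §4 from quasimodular forms and the kernels `𝒦`, `𝒦̂`) and its Kronecker data (§5.3, from
the uniqueness Lemma 5.4 of solutions in the class `𝓟` of `g(τ+2) − 2g(τ+1) + g(τ) = 0`,
`g(τ) + (i/τ)^{d/2} g̃(−1/τ) = 0`). None of this machinery is in Mathlib or in the tree.

## References

* H. Cohn, A. Kumar, S. D. Miller, D. Radchenko, M. Viazovska, *Universal optimality of the `E₈` and
  Leech lattices and interpolation formulas*, Ann. of Math. 196 (2022) 983–1082, arXiv:1902.05438:
  §1.4 (Theorem 1.9), §5.3 (its proof). [CohnEtAl2019]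
-/

noncomputable section

open scoped SchwartzMap FourierTransform Topology ContDiff
open Filter LineDeriv

namespace Literature.Analysis.Fourier

variable {d : ℕ}

section DataDecay

variable [NeZero d]

/-- `r e₀ = r • e₀`. [folklore] -/
theorem axisPt_eq_smul (r : ℝ) : axisPt d r = r • axisPt d 1 := by
  ext i
  by_cases hi : i = 0 <;> simp [axisPt, hi]

/-- `t ↦ t e₀` has derivative `e₀` everywhere. [folklore] -/
theorem hasDerivAt_axisPt (r : ℝ) : HasDerivAt (fun t : ℝ => axisPt d t) (axisPt d 1) r := by
  have : (fun t : ℝ => axisPt d t) = fun t => t • axisPt d 1 := funext axisPt_eq_smul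
  rw [this]
  simpa using (hasDerivAt_id r).smul_const (axisPt d 1)

/-- The radial derivative of a differentiable `f` at `r` is the directional derivative of `f` at
`r e₀` in the direction `e₀` (chain rule along `t ↦ t e₀`). [folklore] -/
theorem radialDeriv_eq_fderiv {f : EuclideanSpace ℝ (Fin d) → ℂ} {r : ℝ}
    (hf : DifferentiableAt ℝ f (axisPt d r)) :
    radialDeriv f r = fderiv ℝ f (axisPt d r) (axisPt d 1) := by
  unfold radialDeriv
  exact (hf.hasFDerivAt.comp_hasDerivAt r (hasDerivAt_axisPt r)).deriv

/-- For a Schwartz map `f`, `f′(r) = (∂_{e₀} f)(r)`: the radial-derivative data of `f` are the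
value data of the Schwartz map `∂_{e₀} f` (cf. CKMRV §2.3, where the radial derivative of a radial
Schwartz function is controlled by Schwartz seminorms). [folklore] -/
theorem radialDeriv_eq_radialValue_lineDeriv (f : 𝓢(EuclideanSpace ℝ (Fin d), ℂ)) (r : ℝ) :
    radialDeriv f r =
      radialValue (∂_{axisPt d 1} f : 𝓢(EuclideanSpace ℝ (Fin d), ℂ)) r := by
  rw [radialDeriv_eq_fderiv f.differentiableAt, radialValue,
    SchwartzMap.lineDerivOp_apply_eq_fderiv]

/-- Schwartz decay along the nodes: `n^{k+1} ‖g(√(2(n₀+n)) e₀)‖` is bounded by the Schwartz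
seminorm `‖g‖_{2(k+1),0}`, because `n ≤ 2(n₀ + n) = ‖√(2(n₀+n)) e₀‖²`. [folklore] -/
theorem pow_mul_norm_radialValue_node_le (g : 𝓢(EuclideanSpace ℝ (Fin d), ℂ)) (n₀ k n : ℕ) :
    (n : ℝ) ^ (k + 1) * ‖radialValue g (node n₀ n)‖ ≤
      SchwartzMap.seminorm ℝ (2 * (k + 1)) 0 g := by
  have h1 := SchwartzMap.norm_pow_mul_le_seminorm ℝ g (2 * (k + 1)) (axisPt d (node n₀ n))
  have h2 : (n : ℝ) ^ (k + 1) ≤ ‖axisPt d (node n₀ n)‖ ^ (2 * (k + 1)) := by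
    rw [norm_axisPt, abs_of_nonneg (node_nonneg _ _), pow_mul, node_sq]
    gcongr
    have : (0 : ℝ) ≤ n₀ := Nat.cast_nonneg _
    linarith
  calc (n : ℝ) ^ (k + 1) * ‖radialValue g (node n₀ n)‖
      ≤ ‖axisPt d (node n₀ n)‖ ^ (2 * (k + 1)) * ‖g (axisPt d (node n₀ n))‖ := by
        unfold radialValue
        gcongr
    _ ≤ SchwartzMap.seminorm ℝ (2 * (k + 1)) 0 g := h1

/-- The values of a Schwartz map on `ℝᵈ` at the nodes `√(2(n₀+n)) e₀`, `n = 0, 1, …`, form a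
rapidly decreasing sequence ("because of the decay of Schwartz functions", CKMRV §5.3):
`nᵏ ‖g(√(2(n₀+n)) e₀)‖ ≤ ‖g‖_{2k+2,0} / n → 0`. [cite: CohnEtAl2019, §5.3 (proof of Theorem 1.9)] -/
theorem isRapidlyDecreasing_radialValue (g : 𝓢(EuclideanSpace ℝ (Fin d), ℂ)) (n₀ : ℕ) :
    IsRapidlyDecreasing fun n => radialValue g (node n₀ n) := by
  intro k
  set C : ℝ := SchwartzMap.seminorm ℝ (2 * (k + 1)) 0 g
  refine squeeze_zero_norm' ?_ (tendsto_const_div_atTop_nhds_zero_nat C)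
  filter_upwards [eventually_ge_atTop 1] with n hn
  have hn' : (0 : ℝ) < n := by exact_mod_cast hn
  rw [Real.norm_of_nonneg (by positivity), le_div_iff₀ hn']
  calc (n : ℝ) ^ k * ‖radialValue g (node n₀ n)‖ * n
      = (n : ℝ) ^ (k + 1) * ‖radialValue g (node n₀ n)‖ := by ring
    _ ≤ C := pow_mul_norm_radialValue_node_le g n₀ k n

/-- **CKMRV Theorem 1.9, the elementary half (part (i) of `InterpolationIsomorphism d n₀`)**: for
every `(d, n₀)` and every Schwartz `f` on `ℝᵈ` (radial or not), the four data sequences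
`(f(√(2n)))`, `(f′(√(2n)))`, `(f̂(√(2n)))`, `(f̂′(√(2n)))`, `n ≥ n₀`, are rapidly decreasing —
"The image of the latter map is contained in `𝓢(ℕ)⁴` because of the decay of Schwartz functions"
(the radial derivative of `f` is the value of the Schwartz map `∂_{e₀} f`, and `f̂ = 𝓕 f` is
Schwartz). [cite: CohnEtAl2019, §5.3 (proof of Theorem 1.9)] -/
theorem isRapidlyDecreasing_data (n₀ : ℕ) (f : 𝓢(EuclideanSpace ℝ (Fin d), ℂ)) :
    IsRapidlyDecreasing (fun n => radialValue f (node n₀ n)) ∧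
      IsRapidlyDecreasing (fun n => radialDeriv f (node n₀ n)) ∧
      IsRapidlyDecreasing
        (fun n => radialValue (𝓕 f : 𝓢(EuclideanSpace ℝ (Fin d), ℂ)) (node n₀ n)) ∧
      IsRapidlyDecreasing
        (fun n => radialDeriv (𝓕 f : 𝓢(EuclideanSpace ℝ (Fin d), ℂ)) (node n₀ n)) := by
  refine ⟨isRapidlyDecreasing_radialValue f n₀, ?_, isRapidlyDecreasing_radialValue _ n₀, ?_⟩
  · simp_rw [radialDeriv_eq_radialValue_lineDeriv f]
    exact isRapidlyDecreasing_radialValue _ n₀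
  · simp_rw [radialDeriv_eq_radialValue_lineDeriv (𝓕 f : 𝓢(EuclideanSpace ℝ (Fin d), ℂ))]
    exact isRapidlyDecreasing_radialValue _ n₀

/-- **Theorem 1.9 from the surjectivity of the data map.** If every quadruple of rapidly
decreasing sequences is the data `((g(√(2n))), (g′(√(2n))), (ĝ(√(2n))), (ĝ′(√(2n))))` of some
radial Schwartz `g` on `ℝᵈ` (CKMRV §1.4: "The only restriction on these sequences is on their
decay rate"; in §5.3 this is obtained from the Kronecker data of the interpolation basis and the
polynomial growth of its radial seminorms, Theorem 3.1), then `InterpolationIsomorphism d n₀`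
holds — for EVERY interpolation basis: part (i) is `isRapidlyDecreasing_data`, and for part (ii)
the preimage `g` of `(α, β, α̃, β̃)` is expanded by the basis identity (1.4), whose four series at
`g` are exactly `∑ αₙ aₙ(x)`, `∑ βₙ bₙ(x)`, `∑ α̃ₙ ãₙ(x)`, `∑ β̃ₙ b̃ₙ(x)`, absolutely convergent by
the basis property. [cite: CohnEtAl2019, §1.4 Theorem 1.9 and §5.3] -/
theorem interpolationIsomorphism_of_data_surjective {n₀ : ℕ}
    (hS : ∀ α β α' β' : ℕ → ℂ, IsRapidlyDecreasing α → IsRapidlyDecreasing β →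
      IsRapidlyDecreasing α' → IsRapidlyDecreasing β' →
      ∃ g : 𝓢(EuclideanSpace ℝ (Fin d), ℂ), IsRadial g ∧
        ∀ n, radialValue g (node n₀ n) = α n ∧ radialDeriv g (node n₀ n) = β n ∧
          radialValue (𝓕 g : 𝓢(EuclideanSpace ℝ (Fin d), ℂ)) (node n₀ n) = α' n ∧
          radialDeriv (𝓕 g : 𝓢(EuclideanSpace ℝ (Fin d), ℂ)) (node n₀ n) = β' n) :
    InterpolationIsomorphism d n₀ := by
  intro a b a' b' h
  refine ⟨fun f _ => isRapidlyDecreasing_data n₀ f, ?_⟩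
  intro α β α' β' hα hβ hα' hβ'
  obtain ⟨g, hg, hdata⟩ := hS α β α' β' hα hβ hα' hβ'
  have h1 : ∀ n, radialValue g (node n₀ n) = α n := fun n => (hdata n).1
  have h2 : ∀ n, radialDeriv g (node n₀ n) = β n := fun n => (hdata n).2.1
  have h3 : ∀ n, radialValue (𝓕 g : 𝓢(EuclideanSpace ℝ (Fin d), ℂ)) (node n₀ n) = α' n :=
    fun n => (hdata n).2.2.1
  have h4 : ∀ n, radialDeriv (𝓕 g : 𝓢(EuclideanSpace ℝ (Fin d), ℂ)) (node n₀ n) = β' n :=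
    fun n => (hdata n).2.2.2
  refine ⟨g, hg, fun x => ⟨?_, ?_, ?_, ?_, ?_⟩, hdata⟩
  · simpa only [h1] using h.summable_a g hg x
  · simpa only [h2] using h.summable_b g hg x
  · simpa only [h3] using h.summable_a' g hg x
  · simpa only [h4] using h.summable_b' g hg x
  · simpa only [h1, h2, h3, h4] using h.eq_tsum g hg x

/-- Conversely, the isomorphism statement contains the surjectivity of the data map onto `𝓢(ℕ)⁴`
(in the presence of an interpolation basis), so the residual hypothesis isolated in
`interpolationIsomorphism_of_data_surjective` is exactly the remaining content of Theorem 1.9.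
[cite: CohnEtAl2019, §1.4 Theorem 1.9] -/
theorem InterpolationIsomorphism.data_surjective {n₀ : ℕ} (hI : InterpolationIsomorphism d n₀)
    {a b a' b' : ℕ → 𝓢(EuclideanSpace ℝ (Fin d), ℂ)} (h : IsInterpolationBasis d n₀ a b a' b')
    (α β α' β' : ℕ → ℂ) (hα : IsRapidlyDecreasing α) (hβ : IsRapidlyDecreasing β)
    (hα' : IsRapidlyDecreasing α') (hβ' : IsRapidlyDecreasing β') :
    ∃ g : 𝓢(EuclideanSpace ℝ (Fin d), ℂ), IsRadial g ∧
      ∀ n, radialValue g (node n₀ n) = α n ∧ radialDeriv g (node n₀ n) = β n ∧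
        radialValue (𝓕 g : 𝓢(EuclideanSpace ℝ (Fin d), ℂ)) (node n₀ n) = α' n ∧
        radialDeriv (𝓕 g : 𝓢(EuclideanSpace ℝ (Fin d), ℂ)) (node n₀ n) = β' n := by
  obtain ⟨g, hg, -, hdata⟩ := (hI a b a' b' h).2 α β α' β' hα hβ hα' hβ'
  exact ⟨g, hg, hdata⟩

end DataDecay

/-- **`CKMRV2022_interpolationIso` from the surjectivity of the two data maps** (`d = 8` from the
node `√2`, `d = 24` from `√4`): the named fact reduced to the core assertion of CKMRV Theorem 1.9
that rapid decay is the only restriction on the data — proved in §5.3 of the paper from the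
explicit basis of Theorem 1.7, Lemma 5.4 and Theorem 3.1, and NOT formalised here.
[cite: CohnEtAl2019, §1.4 Theorem 1.9 and §5.3] -/
theorem CKMRV2022_interpolationIso_of_data_surjective
    (h8 : ∀ α β α' β' : ℕ → ℂ, IsRapidlyDecreasing α → IsRapidlyDecreasing β →
      IsRapidlyDecreasing α' → IsRapidlyDecreasing β' →
      ∃ g : 𝓢(EuclideanSpace ℝ (Fin 8), ℂ), IsRadial g ∧
        ∀ n, radialValue g (node 1 n) = α n ∧ radialDeriv g (node 1 n) = β n ∧
          radialValue (𝓕 g : 𝓢(EuclideanSpace ℝ (Fin 8), ℂ)) (node 1 n) = α' n ∧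
          radialDeriv (𝓕 g : 𝓢(EuclideanSpace ℝ (Fin 8), ℂ)) (node 1 n) = β' n)
    (h24 : ∀ α β α' β' : ℕ → ℂ, IsRapidlyDecreasing α → IsRapidlyDecreasing β →
      IsRapidlyDecreasing α' → IsRapidlyDecreasing β' →
      ∃ g : 𝓢(EuclideanSpace ℝ (Fin 24), ℂ), IsRadial g ∧
        ∀ n, radialValue g (node 2 n) = α n ∧ radialDeriv g (node 2 n) = β n ∧
          radialValue (𝓕 g : 𝓢(EuclideanSpace ℝ (Fin 24), ℂ)) (node 2 n) = α' n ∧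
          radialDeriv (𝓕 g : 𝓢(EuclideanSpace ℝ (Fin 24), ℂ)) (node 2 n) = β' n) :
    CKMRV2022_interpolationIso :=
  ⟨interpolationIsomorphism_of_data_surjective h8, interpolationIsomorphism_of_data_surjective h24⟩


section Synthesis

variable {E : Type*} [NormedAddCommGroup E] [NormedSpace ℝ E]

/-- A rapidly decreasing sequence is absolutely summable against polynomially bounded nonnegative
weights. [folklore] -/
theorem IsRapidlyDecreasing.summable_norm_mul {α : ℕ → ℂ} (hα : IsRapidlyDecreasing α)
    {c : ℕ → ℝ} {C : ℝ} {q : ℕ} (hc : ∀ i, 0 ≤ c i) (hle : ∀ i, c i ≤ C * ((i : ℝ) + 1) ^ q) :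
    Summable fun i => ‖α i‖ * c i := by
  have h1 : ∀ᶠ i : ℕ in atTop, (i : ℝ) ^ (q + 2) * ‖α i‖ ≤ 1 :=
    (hα (q + 2)).eventually_mem (Iic_mem_nhds one_pos)
  refine .of_norm_bounded_eventually_nat
    ((Real.summable_one_div_nat_pow.mpr one_lt_two).mul_left (|C| * 2 ^ q)) ?_
  filter_upwards [h1, eventually_ge_atTop 1] with i hi hi1
  rw [Real.norm_of_nonneg (by positivity [hc i])]
  have hi0 : (1 : ℝ) ≤ i := by exact_mod_cast hi1
  have hCle : C * ((i : ℝ) + 1) ^ q ≤ |C| * ((2 : ℝ) * i) ^ q := by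
    calc C * ((i : ℝ) + 1) ^ q ≤ |C| * ((i : ℝ) + 1) ^ q := by
          gcongr
          exact le_abs_self C
      _ ≤ |C| * ((2 : ℝ) * i) ^ q := by
          gcongr
          linarith
  calc ‖α i‖ * c i ≤ ‖α i‖ * (|C| * ((2 : ℝ) * i) ^ q) := by
        gcongr
        exact (hle i).trans hCle
    _ = |C| * 2 ^ q * ((i : ℝ) ^ (q + 2) * ‖α i‖) * (1 / (i : ℝ) ^ 2) := by
        field_simp
        ring
    _ ≤ |C| * 2 ^ q * 1 * (1 / (i : ℝ) ^ 2) := by gcongr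
    _ = |C| * 2 ^ q * (1 / (i : ℝ) ^ 2) := by ring

/-- Splitting a series over `ℕ` into a finite part over `s` and the series of the remaining terms.
[folklore] -/
theorem tsum_eq_sum_add_tsum_ite {β : Type*} [AddCommGroup β] [TopologicalSpace β]
    [IsTopologicalAddGroup β] [T2Space β] (u : ℕ → β) (s : Finset ℕ)
    (hu : Summable fun i => if i ∈ s then 0 else u i) :
    ∑' i, u i = ∑ i ∈ s, u i + ∑' i, (if i ∈ s then 0 else u i) := by
  have h1 : Summable fun i => if i ∈ s then u i else 0 :=
    summable_of_ne_finset_zero (s := s) (by intro b hb; simp [hb])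
  calc ∑' i, u i = ∑' i, ((if i ∈ s then u i else 0) + (if i ∈ s then 0 else u i)) :=
        tsum_congr fun i => by split_ifs <;> simp
    _ = ∑' i, (if i ∈ s then u i else 0) + ∑' i, (if i ∈ s then 0 else u i) := h1.tsum_add hu
    _ = ∑ i ∈ s, u i + ∑' i, (if i ∈ s then 0 else u i) := by
        rw [tsum_eq_sum (s := s) (fun b hb => by simp [hb])]
        congr 1
        exact Finset.sum_congr rfl fun i hi => by simp [hi]

/-- Termwise smoothness and decay of `x ↦ ∑ᵢ γᵢ φᵢ(x)` for Schwartz `φᵢ` and coefficients with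
`∑ᵢ |γᵢ| ‖φᵢ‖_{k,n} < ∞` for all `k, n`: the sum is smooth, its derivatives are the termwise sums,
and `‖x‖ᵏ ‖Dⁿ(∑ γᵢ φᵢ)(x)‖ ≤ ∑ᵢ |γᵢ| ‖φᵢ‖_{k,n}`. [folklore] -/
theorem contDiff_tsum_schwartz (φ : ℕ → 𝓢(E, ℂ)) (γ : ℕ → ℂ)
    (hγ : ∀ k n, Summable fun i => ‖γ i‖ * SchwartzMap.seminorm ℂ k n (φ i)) :
    ContDiff ℝ ∞ (fun x => ∑' i, γ i * φ i x) ∧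
      ∀ k n x, ‖x‖ ^ k * ‖iteratedFDeriv ℝ n (fun x => ∑' i, γ i * φ i x) x‖ ≤
        ∑' i, ‖γ i‖ * SchwartzMap.seminorm ℂ k n (φ i) := by
  set f : ℕ → E → ℂ := fun i x => γ i * φ i x with hf_def
  have hf : ∀ i, ContDiff ℝ ∞ (f i) := fun i => contDiff_const.mul ((φ i).smooth ⊤)
  have hD : ∀ n i x, iteratedFDeriv ℝ n (f i) x = γ i • iteratedFDeriv ℝ n (φ i) x := by
    intro n i x
    have : f i = γ i • ⇑(φ i) := rfl
    rw [this]
    exact iteratedFDeriv_const_smul_apply ((φ i).smooth _).contDiffAt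
  have h'f : ∀ (k : ℕ) (i : ℕ) (x : E),
      ‖iteratedFDeriv ℝ k (f i) x‖ ≤ ‖γ i‖ * SchwartzMap.seminorm ℂ 0 k (φ i) := by
    intro k i x
    rw [hD, norm_smul]
    gcongr
    exact SchwartzMap.norm_iteratedFDeriv_le_seminorm ℂ (φ i) k x
  have hsmooth : ContDiff ℝ ∞ (fun x => ∑' i, f i x) :=
    contDiff_tsum hf (fun k _ => hγ 0 k) (fun k i x _ => h'f k i x)
  refine ⟨hsmooth, fun k n x => ?_⟩
  rw [iteratedFDeriv_tsum_apply hf (fun k _ => hγ 0 k) (fun k i x _ => h'f k i x) le_top]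
  have hs1 : Summable fun i => ‖iteratedFDeriv ℝ n (f i) x‖ :=
    .of_nonneg_of_le (fun i => norm_nonneg _) (fun i => h'f n i x) (hγ 0 n)
  have hle : ∀ i, ‖x‖ ^ k * ‖iteratedFDeriv ℝ n (f i) x‖ ≤
      ‖γ i‖ * SchwartzMap.seminorm ℂ k n (φ i) := fun i => by
    rw [hD, norm_smul, mul_left_comm]
    gcongr
    exact SchwartzMap.le_seminorm ℂ k n (φ i) x
  have hs2 : Summable fun i => ‖x‖ ^ k * ‖iteratedFDeriv ℝ n (f i) x‖ :=
    .of_nonneg_of_le (fun i => by positivity) hle (hγ k n)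
  calc ‖x‖ ^ k * ‖∑' i, iteratedFDeriv ℝ n (f i) x‖
      ≤ ‖x‖ ^ k * ∑' i, ‖iteratedFDeriv ℝ n (f i) x‖ := by
        gcongr
        exact norm_tsum_le_tsum_norm hs1
    _ = ∑' i, ‖x‖ ^ k * ‖iteratedFDeriv ℝ n (f i) x‖ := by rw [tsum_mul_left]
    _ ≤ ∑' i, ‖γ i‖ * SchwartzMap.seminorm ℂ k n (φ i) := hs2.tsum_le_tsum hle (hγ k n)

/-- **Synthesis of a Schwartz function from rapidly decreasing coefficients.** If `φᵢ` are
Schwartz functions whose every Schwartz seminorm grows at most polynomially in `i`, and `(αᵢ)` is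
rapidly decreasing, then `∑ᵢ αᵢ φᵢ` converges in the Schwartz space (hence also pointwise) to a
Schwartz function `g` — the last step of the proof of CKMRV Theorem 1.9 ("the image of the
inverse map is a radial Schwartz function because the radial seminorms of the interpolation basis
grow at most polynomially"). [cite: CohnEtAl2019, §5.3 (proof of Theorem 1.9)] -/
theorem exists_schwartzMap_hasSum (φ : ℕ → 𝓢(E, ℂ)) (α : ℕ → ℂ) (hα : IsRapidlyDecreasing α)
    (hφ : ∀ k n : ℕ, ∃ C : ℝ, ∃ q : ℕ, ∀ i,
      SchwartzMap.seminorm ℂ k n (φ i) ≤ C * ((i : ℝ) + 1) ^ q) :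
    ∃ g : 𝓢(E, ℂ), HasSum (fun i => α i • φ i) g ∧ ∀ x, HasSum (fun i => α i * φ i x) (g x) := by
  have hw : ∀ k n, Summable fun i => ‖α i‖ * SchwartzMap.seminorm ℂ k n (φ i) := fun k n => by
    obtain ⟨C, q, h⟩ := hφ k n
    exact hα.summable_norm_mul (fun i => apply_nonneg _ _) h
  obtain ⟨hsmooth, hdecay⟩ := contDiff_tsum_schwartz φ α hw
  let g : 𝓢(E, ℂ) := ⟨fun x => ∑' i, α i * φ i x, hsmooth, fun k n => ⟨_, hdecay k n⟩⟩
  have hgx : ∀ x, g x = ∑' i, α i * φ i x := fun x => rfl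
  have hpt_summable : ∀ (γ : ℕ → ℂ), (Summable fun i => ‖γ i‖ * SchwartzMap.seminorm ℂ 0 0 (φ i)) →
      ∀ x, Summable fun i => γ i * φ i x := fun γ hγ x =>
    .of_norm_bounded hγ fun i => by
      rw [norm_mul]
      gcongr
      exact SchwartzMap.norm_le_seminorm ℂ (φ i) x
  refine ⟨g, ?_, fun x => hgx x ▸ (hpt_summable α (hw 0 0) x).hasSum⟩
  rw [HasSum, (schwartz_withSeminorms ℂ E ℂ).tendsto_nhds]
  rintro ⟨k, n⟩ ε hε
  -- the truncated coefficient sequences and the tail bound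
  have key : ∀ s : Finset ℕ, SchwartzMap.seminorm ℂ k n (∑ i ∈ s, α i • φ i - g) ≤
      ∑' i, ‖(if i ∈ s then 0 else α i)‖ * SchwartzMap.seminorm ℂ k n (φ i) := fun s => by
    set αs : ℕ → ℂ := fun i => if i ∈ s then 0 else α i with hαs
    have hws : ∀ k n, Summable fun i => ‖αs i‖ * SchwartzMap.seminorm ℂ k n (φ i) := fun k n =>
      (hw k n).of_nonneg_of_le (fun i => by positivity) fun i => by
        apply mul_le_mul_of_nonneg_right _ (apply_nonneg _ _)
        simp only [hαs]
        split_ifs <;> simp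
    obtain ⟨-, hdecay_s⟩ := contDiff_tsum_schwartz φ αs hws
    refine SchwartzMap.seminorm_le_bound ℂ k n _ (tsum_nonneg fun i => by positivity) fun x => ?_
    have hfun : ⇑(∑ i ∈ s, α i • φ i - g) = -(fun x => ∑' i, αs i * φ i x) := by
      ext x
      have split := tsum_eq_sum_add_tsum_ite (fun i => α i * φ i x) s
        ((hpt_summable αs (hws 0 0) x).congr fun i => by simp only [hαs]; split_ifs <;> simp)
      simp only [sub_apply, sum_apply, smul_apply, smul_eq_mul, hgx, Pi.neg_apply, split]
      have : ∀ i, (if i ∈ s then (0 : ℂ) else α i * φ i x) = αs i * φ i x := fun i => by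
        simp only [hαs]; split_ifs <;> simp
      simp only [this]
      ring
    rw [hfun, iteratedFDeriv_neg_apply, norm_neg]
    exact hdecay_s k n x
  -- the tails tend to zero
  have hT : Tendsto (fun s : Finset ℕ =>
      ∑' i, ‖(if i ∈ s then 0 else α i)‖ * SchwartzMap.seminorm ℂ k n (φ i)) atTop (𝓝 0) := by
    set w : ℕ → ℝ := fun i => ‖α i‖ * SchwartzMap.seminorm ℂ k n (φ i) with hw_def
    have hw' : Summable w := hw k n
    have hrew : ∀ s : Finset ℕ, (∑' i, ‖(if i ∈ s then 0 else α i)‖ * SchwartzMap.seminorm ℂ k n (φ i))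
        = ∑' i, w i - ∑ i ∈ s, w i := fun s => by
      have hws : Summable fun i => if i ∈ s then 0 else w i :=
        hw'.of_nonneg_of_le (fun i => by positivity) fun i => by
          split_ifs
          · exact mul_nonneg (norm_nonneg _) (apply_nonneg _ _)
          · exact le_rfl
      rw [tsum_eq_sum_add_tsum_ite w s hws, add_sub_cancel_left]
      exact tsum_congr fun i => by split_ifs <;> simp [hw_def]
    simp_rw [hrew]
    simpa using (tendsto_const_nhds (x := ∑' i, w i)).sub hw'.hasSum
  filter_upwards [hT.eventually_mem (Iio_mem_nhds hε)] with s hs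
  exact (key s).trans_lt hs

end Synthesis

section KroneckerFamilies

variable {d : ℕ} [NeZero d]

/-- Sums of radial functions are radial. [folklore] -/
theorem IsRadial.add {V F : Type*} [SeminormedAddCommGroup V] [Add F] {f g : V → F}
    (hf : IsRadial f) (hg : IsRadial g) : IsRadial (f + g) := fun x y h => by
  simp only [Pi.add_apply, hf h, hg h]

/-- A pointwise convergent series of radial functions has a radial sum. [folklore] -/
theorem isRadial_of_hasSum {V : Type*} [SeminormedAddCommGroup V] {ι : Type*} {φ : ι → V → ℂ}
    {g : V → ℂ} (hφ : ∀ i, IsRadial (φ i)) (h : ∀ x, HasSum (fun i => φ i x) (g x)) :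
    IsRadial g := fun x y hxy => by
  have : (fun i => φ i x) = fun i => φ i y := funext fun i => hφ i hxy
  exact (h x).unique (this ▸ h y)

/-- Point evaluation of a series convergent in the Schwartz space. [folklore] -/
theorem hasSum_apply_of_hasSum_schwartz {E' : Type*} [NormedAddCommGroup E'] [NormedSpace ℝ E']
    {ι : Type*} {φ : ι → 𝓢(E', ℂ)} {g : 𝓢(E', ℂ)} (h : HasSum φ g) (x : E') :
    HasSum (fun i => φ i x) (g x) := by
  simpa using h.mapL ((BoundedContinuousFunction.evalCLM ℂ x).comp
    (SchwartzMap.toBoundedContinuousFunctionCLM ℂ E' ℂ))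

/-- The four data `g(r)`, `g′(r)`, `ĝ(r)`, `ĝ′(r)` of the sum `g` of a series `∑ αᵢ φᵢ` convergent
in the Schwartz space are the termwise sums: each datum is a continuous linear functional on the
Schwartz space (point evaluation, composed with `∂_{e₀}` and/or `𝓕`). [folklore] -/
theorem hasSum_data {φ : ℕ → 𝓢(EuclideanSpace ℝ (Fin d), ℂ)} {α : ℕ → ℂ}
    {g : 𝓢(EuclideanSpace ℝ (Fin d), ℂ)} (h : HasSum (fun i => α i • φ i) g) (r : ℝ) :
    HasSum (fun i => α i * radialValue (φ i) r) (radialValue g r) ∧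
      HasSum (fun i => α i * radialDeriv (φ i) r) (radialDeriv g r) ∧
      HasSum (fun i => α i * radialValue (𝓕 (φ i) : 𝓢(EuclideanSpace ℝ (Fin d), ℂ)) r)
        (radialValue (𝓕 g : 𝓢(EuclideanSpace ℝ (Fin d), ℂ)) r) ∧
      HasSum (fun i => α i * radialDeriv (𝓕 (φ i) : 𝓢(EuclideanSpace ℝ (Fin d), ℂ)) r)
        (radialDeriv (𝓕 g : 𝓢(EuclideanSpace ℝ (Fin d), ℂ)) r) := by
  have H : ∀ L : 𝓢(EuclideanSpace ℝ (Fin d), ℂ) →L[ℂ] 𝓢(EuclideanSpace ℝ (Fin d), ℂ),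
      HasSum (fun i => α i * L (φ i) (axisPt d r)) (L g (axisPt d r)) := fun L => by
    simpa [map_smul, smul_apply, smul_eq_mul] using
      hasSum_apply_of_hasSum_schwartz (h.mapL L) (axisPt d r)
  refine ⟨?_, ?_, ?_, ?_⟩
  · simpa [radialValue] using H (ContinuousLinearMap.id ℂ _)
  · simpa [radialDeriv_eq_radialValue_lineDeriv, radialValue] using
      H (lineDerivOpCLM ℂ _ (axisPt d 1))
  · simpa [radialValue] using H (SchwartzMap.fourierTransformCLM ℂ)
  · simpa [radialDeriv_eq_radialValue_lineDeriv, radialValue] using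
      H ((lineDerivOpCLM ℂ _ (axisPt d 1)).comp (SchwartzMap.fourierTransformCLM ℂ))

/-- `∑ᵢ [n = i] uᵢ = uₙ`. [folklore] -/
theorem hasSum_ite_eq_apply (n : ℕ) (u : ℕ → ℂ) :
    HasSum (fun i => if n = i then u i else 0) (u n) := by
  convert hasSum_ite_eq n (u n) using 1
  funext i
  by_cases h : i = n
  · subst h; simp
  · simp [h, Ne.symm h]

/-- **Synthesis against a Kronecker family.** Let `φᵢ` (`i = 0, 1, …`, standing for the node
`√(2(n₀+i))`) be radial Schwartz functions on `ℝᵈ` with polynomially growing Schwartz seminorms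
whose data at the nodes are Kronecker: `φᵢ(√(2(n₀+n))) = c₁ δₙᵢ`, `φᵢ′(·) = c₂ δₙᵢ`,
`φ̂ᵢ(·) = c₃ δₙᵢ`, `φ̂ᵢ′(·) = c₄ δₙᵢ`. Then for every rapidly decreasing `(αᵢ)` the series `∑ αᵢ φᵢ`
converges in the Schwartz space to a radial Schwartz `g` with data `(c₁ αₙ, c₂ αₙ, c₃ αₙ, c₄ αₙ)`
— the mechanism of the last paragraph of the proof of CKMRV Theorem 1.9 (there with the four basis
families `aₙ, bₙ, ãₙ, b̃ₙ` and `(c₁, c₂, c₃, c₄)` the four unit vectors).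
[cite: CohnEtAl2019, §5.3 (proof of Theorem 1.9)] -/
theorem exists_isRadial_data_eq_of_kronecker {n₀ : ℕ}
    (φ : ℕ → 𝓢(EuclideanSpace ℝ (Fin d), ℂ)) (hrad : ∀ i, IsRadial (φ i))
    (hgr : ∀ k m : ℕ, ∃ C : ℝ, ∃ q : ℕ, ∀ i,
      SchwartzMap.seminorm ℂ k m (φ i) ≤ C * ((i : ℝ) + 1) ^ q)
    (c₁ c₂ c₃ c₄ : ℂ)
    (h₁ : ∀ i n, radialValue (φ i) (node n₀ n) = if n = i then c₁ else 0)
    (h₂ : ∀ i n, radialDeriv (φ i) (node n₀ n) = if n = i then c₂ else 0)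
    (h₃ : ∀ i n, radialValue (𝓕 (φ i) : 𝓢(EuclideanSpace ℝ (Fin d), ℂ)) (node n₀ n) =
      if n = i then c₃ else 0)
    (h₄ : ∀ i n, radialDeriv (𝓕 (φ i) : 𝓢(EuclideanSpace ℝ (Fin d), ℂ)) (node n₀ n) =
      if n = i then c₄ else 0)
    (α : ℕ → ℂ) (hα : IsRapidlyDecreasing α) :
    ∃ g : 𝓢(EuclideanSpace ℝ (Fin d), ℂ), IsRadial g ∧ HasSum (fun i => α i • φ i) g ∧
      ∀ n, radialValue g (node n₀ n) = c₁ * α n ∧ radialDeriv g (node n₀ n) = c₂ * α n ∧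
        radialValue (𝓕 g : 𝓢(EuclideanSpace ℝ (Fin d), ℂ)) (node n₀ n) = c₃ * α n ∧
        radialDeriv (𝓕 g : 𝓢(EuclideanSpace ℝ (Fin d), ℂ)) (node n₀ n) = c₄ * α n := by
  obtain ⟨g, hg, hgx⟩ := exists_schwartzMap_hasSum φ α hα hgr
  refine ⟨g, isRadial_of_hasSum (φ := fun i x => α i * φ i x)
    (fun i x y hxy => by simp only [hrad i hxy]) hgx, hg, fun n => ?_⟩
  obtain ⟨H1, H2, H3, H4⟩ := hasSum_data hg (node n₀ n)
  simp only [h₁, h₂, h₃, h₄, mul_ite, mul_zero] at H1 H2 H3 H4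
  refine ⟨?_, ?_, ?_, ?_⟩
  · rw [mul_comm]; exact H1.unique (hasSum_ite_eq_apply n fun i => α i * c₁)
  · rw [mul_comm]; exact H2.unique (hasSum_ite_eq_apply n fun i => α i * c₂)
  · rw [mul_comm]; exact H3.unique (hasSum_ite_eq_apply n fun i => α i * c₃)
  · rw [mul_comm]; exact H4.unique (hasSum_ite_eq_apply n fun i => α i * c₄)

/-- The radial derivative is additive on Schwartz maps. [folklore] -/
theorem radialDeriv_add (f g : 𝓢(EuclideanSpace ℝ (Fin d), ℂ)) (r : ℝ) :
    radialDeriv (⇑(f + g)) r = radialDeriv f r + radialDeriv g r := by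
  rw [radialDeriv_eq_radialValue_lineDeriv, radialDeriv_eq_radialValue_lineDeriv,
    radialDeriv_eq_radialValue_lineDeriv, ← lineDerivOpCLM_apply (R := ℂ), map_add]
  rfl

/-- **Surjectivity of the data map from surjectivity onto the four axes** (linearity of the data
map): if every rapidly decreasing sequence is realised as the `f(√(2n))`-data of a radial Schwartz
function with the other three data zero, and likewise for each of the other three slots, then
every quadruple of rapidly decreasing sequences is the data of a radial Schwartz function (their
sum). [folklore] -/
theorem data_surjective_of_axes {n₀ : ℕ}
    (hA : ∀ α : ℕ → ℂ, IsRapidlyDecreasing α → ∃ g : 𝓢(EuclideanSpace ℝ (Fin d), ℂ), IsRadial g ∧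
      ∀ n, radialValue g (node n₀ n) = α n ∧ radialDeriv g (node n₀ n) = 0 ∧
        radialValue (𝓕 g : 𝓢(EuclideanSpace ℝ (Fin d), ℂ)) (node n₀ n) = 0 ∧
        radialDeriv (𝓕 g : 𝓢(EuclideanSpace ℝ (Fin d), ℂ)) (node n₀ n) = 0)
    (hB : ∀ β : ℕ → ℂ, IsRapidlyDecreasing β → ∃ g : 𝓢(EuclideanSpace ℝ (Fin d), ℂ), IsRadial g ∧
      ∀ n, radialValue g (node n₀ n) = 0 ∧ radialDeriv g (node n₀ n) = β n ∧
        radialValue (𝓕 g : 𝓢(EuclideanSpace ℝ (Fin d), ℂ)) (node n₀ n) = 0 ∧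
        radialDeriv (𝓕 g : 𝓢(EuclideanSpace ℝ (Fin d), ℂ)) (node n₀ n) = 0)
    (hA' : ∀ α' : ℕ → ℂ, IsRapidlyDecreasing α' → ∃ g : 𝓢(EuclideanSpace ℝ (Fin d), ℂ),
      IsRadial g ∧ ∀ n, radialValue g (node n₀ n) = 0 ∧ radialDeriv g (node n₀ n) = 0 ∧
        radialValue (𝓕 g : 𝓢(EuclideanSpace ℝ (Fin d), ℂ)) (node n₀ n) = α' n ∧
        radialDeriv (𝓕 g : 𝓢(EuclideanSpace ℝ (Fin d), ℂ)) (node n₀ n) = 0)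
    (hB' : ∀ β' : ℕ → ℂ, IsRapidlyDecreasing β' → ∃ g : 𝓢(EuclideanSpace ℝ (Fin d), ℂ),
      IsRadial g ∧ ∀ n, radialValue g (node n₀ n) = 0 ∧ radialDeriv g (node n₀ n) = 0 ∧
        radialValue (𝓕 g : 𝓢(EuclideanSpace ℝ (Fin d), ℂ)) (node n₀ n) = 0 ∧
        radialDeriv (𝓕 g : 𝓢(EuclideanSpace ℝ (Fin d), ℂ)) (node n₀ n) = β' n)
    (α β α' β' : ℕ → ℂ) (hα : IsRapidlyDecreasing α) (hβ : IsRapidlyDecreasing β)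
    (hα' : IsRapidlyDecreasing α') (hβ' : IsRapidlyDecreasing β') :
    ∃ g : 𝓢(EuclideanSpace ℝ (Fin d), ℂ), IsRadial g ∧
      ∀ n, radialValue g (node n₀ n) = α n ∧ radialDeriv g (node n₀ n) = β n ∧
        radialValue (𝓕 g : 𝓢(EuclideanSpace ℝ (Fin d), ℂ)) (node n₀ n) = α' n ∧
        radialDeriv (𝓕 g : 𝓢(EuclideanSpace ℝ (Fin d), ℂ)) (node n₀ n) = β' n := by
  obtain ⟨g₁, r₁, d₁⟩ := hA α hα
  obtain ⟨g₂, r₂, d₂⟩ := hB β hβ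
  obtain ⟨g₃, r₃, d₃⟩ := hA' α' hα'
  obtain ⟨g₄, r₄, d₄⟩ := hB' β' hβ'
  refine ⟨g₁ + g₂ + g₃ + g₄, ?_, fun n => ?_⟩
  · intro x y hxy
    simp only [add_apply, r₁ hxy, r₂ hxy, r₃ hxy, r₄ hxy]
  · obtain ⟨a₁, a₂, a₃, a₄⟩ := d₁ n
    obtain ⟨b₁, b₂, b₃, b₄⟩ := d₂ n
    obtain ⟨c₁, c₂, c₃, c₄⟩ := d₃ n
    obtain ⟨e₁, e₂, e₃, e₄⟩ := d₄ n
    have hv : ∀ (f g : 𝓢(EuclideanSpace ℝ (Fin d), ℂ)) (r : ℝ),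
        radialValue (⇑(f + g)) r = radialValue f r + radialValue g r := fun f g r => rfl
    simp only [FourierTransform.fourier_add, hv, radialDeriv_add, a₁, a₂, a₃, a₄, b₁, b₂, b₃, b₄,
      c₁, c₂, c₃, c₄, e₁, e₂, e₃, e₄, add_zero, zero_add, and_self]

/-- **Theorem 1.9 from the four Kronecker families** (the architecture of CKMRV §5.3): if for
`(d, n₀)` there are four families `aᵢ, bᵢ, ãᵢ, b̃ᵢ` (`i = 0, 1, …` ↔ nodes `√(2(n₀+i))`) of radial
Schwartz functions on `ℝᵈ` with polynomially growing Schwartz seminorms (CKMRV Theorem 3.1) and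
Kronecker data — `aᵢ` has data `(δᵢ, 0, 0, 0)`, `bᵢ` has `(0, δᵢ, 0, 0)`, `ãᵢ` has
`(0, 0, δᵢ, 0)`, `b̃ᵢ` has `(0, 0, 0, δᵢ)` (the display after Theorem 1.9, proved in §5.3 from
Lemma 5.4) — then the data map is onto `𝓢(ℕ)⁴` (`∑ αᵢaᵢ + ∑ βᵢbᵢ + ∑ α̃ᵢãᵢ + ∑ β̃ᵢb̃ᵢ` converges in
the Schwartz space and has data `(α, β, α̃, β̃)`), hence `InterpolationIsomorphism d n₀` holds.
What is NOT proved here is the existence of such families for `(8, 1)` and `(24, 2)` (the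
interpolation basis of Theorem 1.7 with its growth bounds and Kronecker data).
[cite: CohnEtAl2019, §1.4 Theorem 1.9 and §5.3] -/
theorem interpolationIsomorphism_of_kronecker_families {n₀ : ℕ}
    (hA : ∃ a : ℕ → 𝓢(EuclideanSpace ℝ (Fin d), ℂ), (∀ i, IsRadial (a i)) ∧
      (∀ k m : ℕ, ∃ C : ℝ, ∃ q : ℕ, ∀ i,
        SchwartzMap.seminorm ℂ k m (a i) ≤ C * ((i : ℝ) + 1) ^ q) ∧
      ∀ i n, radialValue (a i) (node n₀ n) = (if n = i then 1 else 0) ∧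
        radialDeriv (a i) (node n₀ n) = 0 ∧
        radialValue (𝓕 (a i) : 𝓢(EuclideanSpace ℝ (Fin d), ℂ)) (node n₀ n) = 0 ∧
        radialDeriv (𝓕 (a i) : 𝓢(EuclideanSpace ℝ (Fin d), ℂ)) (node n₀ n) = 0)
    (hB : ∃ b : ℕ → 𝓢(EuclideanSpace ℝ (Fin d), ℂ), (∀ i, IsRadial (b i)) ∧
      (∀ k m : ℕ, ∃ C : ℝ, ∃ q : ℕ, ∀ i,
        SchwartzMap.seminorm ℂ k m (b i) ≤ C * ((i : ℝ) + 1) ^ q) ∧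
      ∀ i n, radialValue (b i) (node n₀ n) = 0 ∧
        radialDeriv (b i) (node n₀ n) = (if n = i then 1 else 0) ∧
        radialValue (𝓕 (b i) : 𝓢(EuclideanSpace ℝ (Fin d), ℂ)) (node n₀ n) = 0 ∧
        radialDeriv (𝓕 (b i) : 𝓢(EuclideanSpace ℝ (Fin d), ℂ)) (node n₀ n) = 0)
    (hA' : ∃ a' : ℕ → 𝓢(EuclideanSpace ℝ (Fin d), ℂ), (∀ i, IsRadial (a' i)) ∧
      (∀ k m : ℕ, ∃ C : ℝ, ∃ q : ℕ, ∀ i,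
        SchwartzMap.seminorm ℂ k m (a' i) ≤ C * ((i : ℝ) + 1) ^ q) ∧
      ∀ i n, radialValue (a' i) (node n₀ n) = 0 ∧ radialDeriv (a' i) (node n₀ n) = 0 ∧
        radialValue (𝓕 (a' i) : 𝓢(EuclideanSpace ℝ (Fin d), ℂ)) (node n₀ n) =
          (if n = i then 1 else 0) ∧
        radialDeriv (𝓕 (a' i) : 𝓢(EuclideanSpace ℝ (Fin d), ℂ)) (node n₀ n) = 0)
    (hB' : ∃ b' : ℕ → 𝓢(EuclideanSpace ℝ (Fin d), ℂ), (∀ i, IsRadial (b' i)) ∧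
      (∀ k m : ℕ, ∃ C : ℝ, ∃ q : ℕ, ∀ i,
        SchwartzMap.seminorm ℂ k m (b' i) ≤ C * ((i : ℝ) + 1) ^ q) ∧
      ∀ i n, radialValue (b' i) (node n₀ n) = 0 ∧ radialDeriv (b' i) (node n₀ n) = 0 ∧
        radialValue (𝓕 (b' i) : 𝓢(EuclideanSpace ℝ (Fin d), ℂ)) (node n₀ n) = 0 ∧
        radialDeriv (𝓕 (b' i) : 𝓢(EuclideanSpace ℝ (Fin d), ℂ)) (node n₀ n) =
          (if n = i then 1 else 0)) :
    InterpolationIsomorphism d n₀ := by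
  obtain ⟨a, ra, ga, da⟩ := hA
  obtain ⟨b, rb, gb, db⟩ := hB
  obtain ⟨a', ra', ga', da'⟩ := hA'
  obtain ⟨b', rb', gb', db'⟩ := hB'
  have e0 : ∀ {z : ℂ} {n i : ℕ}, z = 0 → z = if n = i then 0 else 0 := fun h => by
    rw [ite_self]; exact h
  apply interpolationIsomorphism_of_data_surjective
  apply data_surjective_of_axes
  · intro α hα
    obtain ⟨g, hg, -, hd⟩ := exists_isRadial_data_eq_of_kronecker a ra ga 1 0 0 0
      (fun i n => (da i n).1) (fun i n => e0 (da i n).2.1) (fun i n => e0 (da i n).2.2.1)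
      (fun i n => e0 (da i n).2.2.2) α hα
    exact ⟨g, hg, fun n => by simpa using hd n⟩
  · intro β hβ
    obtain ⟨g, hg, -, hd⟩ := exists_isRadial_data_eq_of_kronecker b rb gb 0 1 0 0
      (fun i n => e0 (db i n).1) (fun i n => (db i n).2.1) (fun i n => e0 (db i n).2.2.1)
      (fun i n => e0 (db i n).2.2.2) β hβ
    exact ⟨g, hg, fun n => by simpa using hd n⟩
  · intro α' hα'
    obtain ⟨g, hg, -, hd⟩ := exists_isRadial_data_eq_of_kronecker a' ra' ga' 0 0 1 0
      (fun i n => e0 (da' i n).1) (fun i n => e0 (da' i n).2.1) (fun i n => (da' i n).2.2.1)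
      (fun i n => e0 (da' i n).2.2.2) α' hα'
    exact ⟨g, hg, fun n => by simpa using hd n⟩
  · intro β' hβ'
    obtain ⟨g, hg, -, hd⟩ := exists_isRadial_data_eq_of_kronecker b' rb' gb' 0 0 0 1
      (fun i n => e0 (db' i n).1) (fun i n => e0 (db' i n).2.1) (fun i n => e0 (db' i n).2.2.1)
      (fun i n => (db' i n).2.2.2) β' hβ'
    exact ⟨g, hg, fun n => by simpa using hd n⟩

end KroneckerFamilies

section Consequences

/-! ## The printed consequences of Theorem 1.9 (CKMRV §1.4, display after Theorem 1.9)

Conditional on `InterpolationIsomorphism d n₀` (as `InterpolationIsomorphism.data_a` in the parent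
file): the Kronecker data of `bₙ`, `ãₙ`, `b̃ₙ`, and "Furthermore, it follows that `ãₙ = âₙ` and
`b̃ₙ = b̂ₙ`" (the Fourier transform of a radial Schwartz function is radial, `𝓕𝓕 = id` on radial
functions, and two radial Schwartz functions with the same data coincide). -/

variable {d : ℕ}

/-- The Fourier transform of a radial function on `ℝᵈ` is radial (`𝓕 (f ∘ A) = (𝓕 f) ∘ A` for a
linear isometry `A`, and `O(d)` is transitive on spheres: the reflection in the bisector of
`x, y` with `‖x‖ = ‖y‖` swaps them). [folklore] -/
theorem IsRadial.fourier {f : EuclideanSpace ℝ (Fin d) → ℂ} (hf : IsRadial f) :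
    IsRadial (𝓕 f) := by
  intro x y hxy
  set A : EuclideanSpace ℝ (Fin d) ≃ₗᵢ[ℝ] EuclideanSpace ℝ (Fin d) :=
    Submodule.reflection (ℝ ∙ (y - x))ᗮ
  have hA : A y = x := Submodule.reflection_sub hxy.symm
  have hfA : f ∘ A = f := funext fun z => hf (by simp)
  calc 𝓕 f x = 𝓕 f (A y) := by rw [hA]
    _ = 𝓕 (f ∘ A) y := (Real.fourier_comp_linearIsometry A f y).symm
    _ = 𝓕 f y := by rw [hfA]

/-- The Fourier transform of a radial Schwartz function is a radial Schwartz function.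
[folklore] -/
theorem IsRadial.fourier_schwartz {f : 𝓢(EuclideanSpace ℝ (Fin d), ℂ)} (hf : IsRadial f) :
    IsRadial (𝓕 f : 𝓢(EuclideanSpace ℝ (Fin d), ℂ)) := by
  rw [SchwartzMap.fourier_coe]
  exact hf.fourier

/-- `𝓕 (𝓕 f) = f` for a radial Schwartz function (`𝓕𝓕 f (x) = f(−x)` and radial functions are
even). [folklore] -/
theorem IsRadial.fourier_fourier {f : 𝓢(EuclideanSpace ℝ (Fin d), ℂ)} (hf : IsRadial f) :
    (𝓕 (𝓕 f : 𝓢(EuclideanSpace ℝ (Fin d), ℂ)) : 𝓢(EuclideanSpace ℝ (Fin d), ℂ)) = f := by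
  ext x
  calc (𝓕 (𝓕 f : 𝓢(EuclideanSpace ℝ (Fin d), ℂ)) : 𝓢(EuclideanSpace ℝ (Fin d), ℂ)) x
      = 𝓕 (⇑(𝓕 f : 𝓢(EuclideanSpace ℝ (Fin d), ℂ))) x := by rw [SchwartzMap.fourier_coe]
    _ = 𝓕⁻ (⇑(𝓕 f : 𝓢(EuclideanSpace ℝ (Fin d), ℂ))) (-x) := by
        rw [Real.fourierInv_eq_fourier_neg, neg_neg]
    _ = (𝓕⁻ (𝓕 f : 𝓢(EuclideanSpace ℝ (Fin d), ℂ)) : 𝓢(EuclideanSpace ℝ (Fin d), ℂ)) (-x) := by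
        rw [SchwartzMap.fourierInv_coe]
    _ = f (-x) := by rw [FourierTransform.fourierInv_fourier_eq]
    _ = f x := hf (norm_neg x)

variable [NeZero d] {n₀ : ℕ} {a b a' b' : ℕ → 𝓢(EuclideanSpace ℝ (Fin d), ℂ)}

/-- **Kronecker data of `bₘ`** (CKMRV §1.4, display after Theorem 1.9, second row:
`bₙ(√(2m)) = 0`, `bₙ′(√(2m)) = δₘₙ`, `b̂ₙ(√(2m)) = 0`, `b̂ₙ′(√(2m)) = 0`), from the isomorphism: the
series with data `(0, δₘ, 0, 0)` is `bₘ` itself. [cite: CohnEtAl2019, §1.4 (display after Theorem 1.9)] -/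
theorem InterpolationIsomorphism.data_b (hI : InterpolationIsomorphism d n₀)
    (h : IsInterpolationBasis d n₀ a b a' b') (m n : ℕ) :
    radialValue (b m) (node n₀ n) = 0 ∧ radialDeriv (b m) (node n₀ n) = (if n = m then 1 else 0) ∧
      radialValue (𝓕 (b m) : 𝓢(EuclideanSpace ℝ (Fin d), ℂ)) (node n₀ n) = 0 ∧
      radialDeriv (𝓕 (b m) : 𝓢(EuclideanSpace ℝ (Fin d), ℂ)) (node n₀ n) = 0 := by
  classical
  set δ : ℕ → ℂ := fun n => if n = m then 1 else 0 with hδ_def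
  have hδ : IsRapidlyDecreasing δ :=
    isRapidlyDecreasing_of_eventually_eq_zero <| by
      filter_upwards [eventually_gt_atTop m] with n hn
      simp [δ, hn.ne']
  obtain ⟨g, -, hgx, hdata⟩ := (hI a b a' b' h).2 0 δ 0 0 isRapidlyDecreasing_zero hδ
    isRapidlyDecreasing_zero isRapidlyDecreasing_zero
  have hgb : g = b m := by
    ext x
    obtain ⟨-, -, -, -, hx⟩ := hgx x
    rw [hx]
    have h1 : (∑' n, δ n * b n x) = b m x := by
      rw [tsum_eq_single m fun n hn => by simp [δ, hn]]
      simp [δ]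
    simp [h1]
  simpa [hgb, δ] using hdata n

/-- **Kronecker data of `ãₘ`** (third row of the display after Theorem 1.9:
`ãₙ(√(2m)) = 0`, `ãₙ′(√(2m)) = 0`, `(𝓕ãₙ)(√(2m)) = δₘₙ`, `(𝓕ãₙ)′(√(2m)) = 0`): the series with
data `(0, 0, δₘ, 0)` is `ãₘ`. [cite: CohnEtAl2019, §1.4 (display after Theorem 1.9)] -/
theorem InterpolationIsomorphism.data_a' (hI : InterpolationIsomorphism d n₀)
    (h : IsInterpolationBasis d n₀ a b a' b') (m n : ℕ) :
    radialValue (a' m) (node n₀ n) = 0 ∧ radialDeriv (a' m) (node n₀ n) = 0 ∧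
      radialValue (𝓕 (a' m) : 𝓢(EuclideanSpace ℝ (Fin d), ℂ)) (node n₀ n) =
        (if n = m then 1 else 0) ∧
      radialDeriv (𝓕 (a' m) : 𝓢(EuclideanSpace ℝ (Fin d), ℂ)) (node n₀ n) = 0 := by
  classical
  set δ : ℕ → ℂ := fun n => if n = m then 1 else 0 with hδ_def
  have hδ : IsRapidlyDecreasing δ :=
    isRapidlyDecreasing_of_eventually_eq_zero <| by
      filter_upwards [eventually_gt_atTop m] with n hn
      simp [δ, hn.ne']
  obtain ⟨g, -, hgx, hdata⟩ := (hI a b a' b' h).2 0 0 δ 0 isRapidlyDecreasing_zero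
    isRapidlyDecreasing_zero hδ isRapidlyDecreasing_zero
  have hga : g = a' m := by
    ext x
    obtain ⟨-, -, -, -, hx⟩ := hgx x
    rw [hx]
    have h1 : (∑' n, δ n * a' n x) = a' m x := by
      rw [tsum_eq_single m fun n hn => by simp [δ, hn]]
      simp [δ]
    simp [h1]
  simpa [hga, δ] using hdata n

/-- **Kronecker data of `b̃ₘ`** (fourth row of the display after Theorem 1.9:
`b̃ₙ(√(2m)) = 0`, `b̃ₙ′(√(2m)) = 0`, `(𝓕b̃ₙ)(√(2m)) = 0`, `(𝓕b̃ₙ)′(√(2m)) = δₘₙ`): the series with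
data `(0, 0, 0, δₘ)` is `b̃ₘ`. [cite: CohnEtAl2019, §1.4 (display after Theorem 1.9)] -/
theorem InterpolationIsomorphism.data_b' (hI : InterpolationIsomorphism d n₀)
    (h : IsInterpolationBasis d n₀ a b a' b') (m n : ℕ) :
    radialValue (b' m) (node n₀ n) = 0 ∧ radialDeriv (b' m) (node n₀ n) = 0 ∧
      radialValue (𝓕 (b' m) : 𝓢(EuclideanSpace ℝ (Fin d), ℂ)) (node n₀ n) = 0 ∧
      radialDeriv (𝓕 (b' m) : 𝓢(EuclideanSpace ℝ (Fin d), ℂ)) (node n₀ n) =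
        (if n = m then 1 else 0) := by
  classical
  set δ : ℕ → ℂ := fun n => if n = m then 1 else 0 with hδ_def
  have hδ : IsRapidlyDecreasing δ :=
    isRapidlyDecreasing_of_eventually_eq_zero <| by
      filter_upwards [eventually_gt_atTop m] with n hn
      simp [δ, hn.ne']
  obtain ⟨g, -, hgx, hdata⟩ := (hI a b a' b' h).2 0 0 0 δ isRapidlyDecreasing_zero
    isRapidlyDecreasing_zero isRapidlyDecreasing_zero hδ
  have hgb : g = b' m := by
    ext x
    obtain ⟨-, -, -, -, hx⟩ := hgx x
    rw [hx]
    have h1 : (∑' n, δ n * b' n x) = b' m x := by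
      rw [tsum_eq_single m fun n hn => by simp [δ, hn]]
      simp [δ]
    simp [h1]
  simpa [hgb, δ] using hdata n

/-- **`ãₘ = âₘ`** (CKMRV §1.4: "Furthermore, it follows that `ãₙ = âₙ` and `b̃ₙ = b̂ₙ`"): `âₘ` is
a radial Schwartz function with the same data `(0, 0, δₘ, 0)` as `ãₘ` (its values/derivatives at
the nodes are the `f̂`-data of `aₘ`, and `𝓕âₘ = aₘ`), so they coincide by uniqueness.
[cite: CohnEtAl2019, §1.4 (display after Theorem 1.9)] -/
theorem InterpolationIsomorphism.a'_eq_fourier_a (hI : InterpolationIsomorphism d n₀)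
    (h : IsInterpolationBasis d n₀ a b a' b') (m : ℕ) :
    a' m = 𝓕 (a m) := by
  refine h.eq_of_data_eq (h.isRadial_a' m) (h.isRadial_a m).fourier_schwartz
    (fun n => ?_) (fun n => ?_) (fun n => ?_) (fun n => ?_)
  · rw [(hI.data_a' h m n).1, (hI.data_a h m n).2.2.1]
  · rw [(hI.data_a' h m n).2.1, (hI.data_a h m n).2.2.2]
  · rw [(hI.data_a' h m n).2.2.1, (h.isRadial_a m).fourier_fourier, (hI.data_a h m n).1]
  · rw [(hI.data_a' h m n).2.2.2, (h.isRadial_a m).fourier_fourier, (hI.data_a h m n).2.1]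

/-- **`b̃ₘ = b̂ₘ`** (CKMRV §1.4, same sentence): `b̂ₘ` is radial Schwartz with the data
`(0, 0, 0, δₘ)` of `b̃ₘ`. [cite: CohnEtAl2019, §1.4 (display after Theorem 1.9)] -/
theorem InterpolationIsomorphism.b'_eq_fourier_b (hI : InterpolationIsomorphism d n₀)
    (h : IsInterpolationBasis d n₀ a b a' b') (m : ℕ) :
    b' m = 𝓕 (b m) := by
  refine h.eq_of_data_eq (h.isRadial_b' m) (h.isRadial_b m).fourier_schwartz
    (fun n => ?_) (fun n => ?_) (fun n => ?_) (fun n => ?_)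
  · rw [(hI.data_b' h m n).1, (hI.data_b h m n).2.2.1]
  · rw [(hI.data_b' h m n).2.1, (hI.data_b h m n).2.2.2]
  · rw [(hI.data_b' h m n).2.2.1, (h.isRadial_b m).fourier_fourier, (hI.data_b h m n).1]
  · rw [(hI.data_b' h m n).2.2.2, (h.isRadial_b m).fourier_fourier, (hI.data_b h m n).2.1]

end Consequences

end Literature.Analysis.Fourier
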